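import Summits.RiemannHypothesis.RiemannHypothesis.Theorems.SoloInformedQuasiWeilCell

/-!
# Exponential slack in Weil's criterion, V: the strip lemma; sparse exceptional sets

Solo programme `solo-RiemannHypothesis-informed`, session 2 — part of the exact-thermometer
package; the overview, the main theorem `width_iff_weilQuadratic_sobolev_subexp` and the
references are in `SoloInformedQuasiWeil.lean`. Everything here is proved (no named facts).

`∑ w_i |ĝ(1/2 + β_i + iγ_i)|² ≤ 2πd(1+Θa)(3+a²)e^{Θa}‖g‖₂²` for `|β_i| ≤ Θ/2` and weights of
local count `≤ d` (`sum_mul_norm_sq_weilMellin_strip_le`), and the consequence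
`weilGroundEnergy_ge_of_sparse_offline`: width `Θ` plus bounded local count of OFF-LINE zeros
gives `ε(a) ≥ -C(1+a)³e^{Θa}` (so a negativity rate above the width forces vertical clustering).
-/

noncomputable section

open Complex Filter Set MeasureTheory
open scoped Real Topology ComplexConjugate ArithmeticFunction.vonMangoldt

namespace Summit.RiemannHypothesis.RiemannHypothesis.Theorems

open Literature.NumberTheory.LFunctions Literature.NumberTheory.LFunctions.WeilConverse

open intervalIntegral

variable {g : ℝ → ℂ}

/-! ### Sampling `ĝ` on a strip with bounded local count -/

/-- `2uv ≤ a u² + a⁻¹ v²` for `a > 0`. [folklore] -/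
theorem two_mul_le_weighted {a u v : ℝ} (ha : 0 < a) : 2 * (u * v) ≤ a * u ^ 2 + a⁻¹ * v ^ 2 := by
  have key : a * (a * u ^ 2 + a⁻¹ * v ^ 2 - 2 * (u * v)) = (a * u - v) ^ 2 := by
    field_simp
    ring
  have : 0 ≤ a * (a * u ^ 2 + a⁻¹ * v ^ 2 - 2 * (u * v)) := by rw [key]; positivity
  have := (mul_nonneg_iff_of_pos_left ha).1 this
  linarith

/-- **Sampling bound on a strip.** For a test function `g` supported in `[-a, a]` (`a > 0`),
points `1/2 + β_i + iγ_i` with `|β_i| ≤ Θ/2` (`Θ > 0`) and weights `w_i ≥ 0` whose ordinates have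
local count `≤ d` (total weight of `|γ_i - t| ≤ 1/2` at most `d` for every `t`):
`∑_i w_i |ĝ(1/2 + β_i + iγ_i)|² ≤ 2π d (1 + Θa)(3 + a²) e^{Θa} ‖g‖₂²`. The proof is real-variable:
a one-sided Sobolev cell in `σ` inside the strip, the tilt `ĝ(1/2 + σ + it) = (g e^{σx})^(1/2 + it)`,
and the local-count Bessel bound on the critical line. [folklore] -/
theorem sum_mul_norm_sq_weilMellin_strip_le {ι : Type*} (T : Finset ι) (β γ : ι → ℝ) (w : ι → ℝ)
    (hw : ∀ i, 0 ≤ w i) {Θ d a : ℝ} (hΘ : 0 < Θ) (hβ : ∀ i ∈ T, |β i| ≤ Θ / 2)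
    (hd : ∀ t : ℝ, ∑ i ∈ T.filter (fun i ↦ |γ i - t| ≤ 1 / 2), w i ≤ d)
    (hg : IsWeilTest g) (ha : 0 < a) (hga : tsupport g ⊆ Icc (-a) a) :
    ∑ i ∈ T, w i * ‖weilMellin g (1 / 2 + β i + γ i * I)‖ ^ 2 ≤
      2 * π * d * (1 + Θ * a) * (3 + a ^ 2) * Real.exp (Θ * a) * weilNorm2Sq g := by
  classical
  set xg : ℝ → ℂ := fun x : ℝ ↦ (x : ℂ) * g x with hxg_def
  have hxg : IsWeilTest xg := hg.ofReal_mul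
  have hxga : tsupport xg ⊆ Icc (-a) a := (tsupport_mul_subset_right).trans hga
  have hd0 : 0 ≤ d := le_trans (Finset.sum_nonneg fun i _ ↦ hw i) (hd 0)
  have h0 : 0 ≤ weilNorm2Sq g := integral_nonneg fun _ ↦ by positivity
  set K : ℝ := d * (π * (3 + a ^ 2)) * (Real.exp (Θ * a) * weilNorm2Sq g) with hK
  have hK0 : 0 ≤ K := by positivity
  -- the line sums at level `σ`
  set F : ι → ℝ → ℂ := fun i σ ↦ weilMellin g (1 / 2 + γ i * I + σ) with hF
  set F' : ι → ℝ → ℂ := fun i σ ↦ weilMellin xg (1 / 2 + γ i * I + σ) with hF'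
  have hFc : ∀ i, Continuous (F i) := fun i ↦
    (continuous_weilMellin hg.1.continuous hg.2).comp (by fun_prop)
  have hF'c : ∀ i, Continuous (F' i) := fun i ↦
    (continuous_weilMellin hxg.1.continuous hxg.2).comp (by fun_prop)
  set S : ℝ → ℝ := fun σ ↦ ∑ i ∈ T, w i * ‖F i σ‖ ^ 2 with hS
  set S' : ℝ → ℝ := fun σ ↦ ∑ i ∈ T, w i * ‖F' i σ‖ ^ 2 with hS'
  have hSc : Continuous S := continuous_finsetSum _ fun i _ ↦ continuous_const.mul ((hFc i).norm.pow 2)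
  have hS'c : Continuous S' := continuous_finsetSum _ fun i _ ↦ continuous_const.mul ((hF'c i).norm.pow 2)
  -- exponential weights on the strip
  have hexpσ : ∀ σ : ℝ, |σ| ≤ Θ / 2 → Real.exp (2 * |σ| * a) ≤ Real.exp (Θ * a) := fun σ hσ ↦
    Real.exp_le_exp.2 (by nlinarith)
  -- the local-count Bessel bound at each level
  have hSle : ∀ σ : ℝ, |σ| ≤ Θ / 2 → S σ ≤ K := by
    intro σ hσ
    have htilt := isWeilTest_mul_cexp_real hg σ
    have hsuppt := (tsupport_mul_cexp_real_subset g σ).trans hga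
    have h1 := sum_mul_norm_sq_weilMellin_line_le_of_localCount T γ w hw hd htilt hsuppt
    simp_rw [weilMellin_mul_cexp_real] at h1
    refine h1.trans ?_
    have h2 : weilNorm2Sq (fun t ↦ g t * cexp ((σ : ℂ) * t)) ≤ Real.exp (Θ * a) * weilNorm2Sq g :=
      (weilNorm2Sq_mul_cexp_real_le hg hga σ).trans (mul_le_mul_of_nonneg_right (hexpσ σ hσ) h0)
    calc d * (π * (3 + a ^ 2) * weilNorm2Sq (fun t ↦ g t * cexp ((σ : ℂ) * t)))
        ≤ d * (π * (3 + a ^ 2) * (Real.exp (Θ * a) * weilNorm2Sq g)) :=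
          mul_le_mul_of_nonneg_left (mul_le_mul_of_nonneg_left h2 (by positivity)) hd0
      _ = K := by rw [hK]; ring
  have hS'le : ∀ σ : ℝ, |σ| ≤ Θ / 2 → S' σ ≤ a ^ 2 * K := by
    intro σ hσ
    have htilt := isWeilTest_mul_cexp_real hxg σ
    have hsuppt := (tsupport_mul_cexp_real_subset xg σ).trans hxga
    have h1 := sum_mul_norm_sq_weilMellin_line_le_of_localCount T γ w hw hd htilt hsuppt
    simp_rw [weilMellin_mul_cexp_real] at h1
    refine h1.trans ?_
    have h2 : weilNorm2Sq (fun t ↦ xg t * cexp ((σ : ℂ) * t)) ≤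
        Real.exp (Θ * a) * (a ^ 2 * weilNorm2Sq g) :=
      (weilNorm2Sq_mul_cexp_real_le hxg hxga σ).trans
        (mul_le_mul (hexpσ σ hσ) (weilNorm2Sq_ofReal_mul_le hg hga)
          (integral_nonneg fun _ ↦ by positivity) (by positivity))
    calc d * (π * (3 + a ^ 2) * weilNorm2Sq (fun t ↦ xg t * cexp ((σ : ℂ) * t)))
        ≤ d * (π * (3 + a ^ 2) * (Real.exp (Θ * a) * (a ^ 2 * weilNorm2Sq g))) :=
          mul_le_mul_of_nonneg_left (mul_le_mul_of_nonneg_left h2 (by positivity)) hd0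
      _ = a ^ 2 * K := by rw [hK]; ring
  -- pointwise `σ`-cell bound for each sample point
  have hpt : ∀ i ∈ T, ‖weilMellin g (1 / 2 + β i + γ i * I)‖ ^ 2 ≤
      (2 / Θ) * (∫ σ in (-(Θ / 2))..(Θ / 2), ‖F i σ‖ ^ 2) +
        ∫ σ in (-(Θ / 2))..(Θ / 2), 2 * (‖F i σ‖ * ‖F' i σ‖) := by
    intro i hi
    have := norm_sq_weilMellin_le_integral_sigma hg (1 / 2 + γ i * I) hΘ (hβ i hi)
    rwa [show (1 : ℂ) / 2 + γ i * I + (β i : ℂ) = 1 / 2 + β i + γ i * I by ring] at this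
  have hΘle : -(Θ / 2) ≤ Θ / 2 := by linarith
  have hmemσ : ∀ σ ∈ Icc (-(Θ / 2)) (Θ / 2), |σ| ≤ Θ / 2 := fun σ hσ ↦ abs_le.2 ⟨hσ.1, hσ.2⟩
  -- first sum: `∑ w_i ∫ ‖F_i‖² = ∫ S ≤ Θ K`
  have hI1 : ∑ i ∈ T, w i * ∫ σ in (-(Θ / 2))..(Θ / 2), ‖F i σ‖ ^ 2 ≤ Θ * K := by
    have e : ∑ i ∈ T, w i * ∫ σ in (-(Θ / 2))..(Θ / 2), ‖F i σ‖ ^ 2 =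
        ∫ σ in (-(Θ / 2))..(Θ / 2), S σ := by
      rw [hS, intervalIntegral.integral_finsetSum]
      · refine Finset.sum_congr rfl fun i _ ↦ ?_
        rw [intervalIntegral.integral_const_mul]
      · intro i _
        exact (continuous_const.mul ((hFc i).norm.pow 2)).intervalIntegrable _ _
    rw [e]
    calc ∫ σ in (-(Θ / 2))..(Θ / 2), S σ ≤ ∫ _ in (-(Θ / 2))..(Θ / 2), K :=
          intervalIntegral.integral_mono_on hΘle (hSc.intervalIntegrable _ _)
            intervalIntegrable_const fun σ hσ ↦ hSle σ (hmemσ σ hσ)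
      _ = Θ * K := by rw [intervalIntegral.integral_const, smul_eq_mul]; ring
  -- second sum: `∑ w_i ∫ 2‖F_i‖‖F'_i‖ ≤ ∫ (a S + a⁻¹ S') ≤ Θ (a K + a⁻¹ a² K)`
  have hI2 : ∑ i ∈ T, w i * ∫ σ in (-(Θ / 2))..(Θ / 2), 2 * (‖F i σ‖ * ‖F' i σ‖) ≤
      2 * Θ * a * K := by
    have e : ∑ i ∈ T, w i * ∫ σ in (-(Θ / 2))..(Θ / 2), 2 * (‖F i σ‖ * ‖F' i σ‖) =
        ∫ σ in (-(Θ / 2))..(Θ / 2), ∑ i ∈ T, w i * (2 * (‖F i σ‖ * ‖F' i σ‖)) := by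
      rw [intervalIntegral.integral_finsetSum]
      · exact Finset.sum_congr rfl fun i _ ↦
          (intervalIntegral.integral_const_mul (w i) (fun σ ↦ 2 * (‖F i σ‖ * ‖F' i σ‖))).symm
      · intro i _
        exact (continuous_const.mul (continuous_const.mul
          ((hFc i).norm.mul (hF'c i).norm))).intervalIntegrable _ _
    rw [e]
    have hcont : Continuous fun σ ↦ ∑ i ∈ T, w i * (2 * (‖F i σ‖ * ‖F' i σ‖)) :=
      continuous_finsetSum _ fun i _ ↦
        continuous_const.mul (continuous_const.mul ((hFc i).norm.mul (hF'c i).norm))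
    calc ∫ σ in (-(Θ / 2))..(Θ / 2), ∑ i ∈ T, w i * (2 * (‖F i σ‖ * ‖F' i σ‖))
        ≤ ∫ _ in (-(Θ / 2))..(Θ / 2), (a * K + a⁻¹ * (a ^ 2 * K)) := by
          refine intervalIntegral.integral_mono_on hΘle (hcont.intervalIntegrable _ _)
            intervalIntegrable_const fun σ hσ ↦ ?_
          have hσ' := hmemσ σ hσ
          calc ∑ i ∈ T, w i * (2 * (‖F i σ‖ * ‖F' i σ‖))
              ≤ ∑ i ∈ T, w i * (a * ‖F i σ‖ ^ 2 + a⁻¹ * ‖F' i σ‖ ^ 2) :=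
                Finset.sum_le_sum fun i _ ↦
                  mul_le_mul_of_nonneg_left (two_mul_le_weighted ha) (hw i)
            _ = a * S σ + a⁻¹ * S' σ := by
                rw [hS, hS', Finset.mul_sum, Finset.mul_sum, ← Finset.sum_add_distrib]
                refine Finset.sum_congr rfl fun i _ ↦ ?_
                ring
            _ ≤ a * K + a⁻¹ * (a ^ 2 * K) := by
                gcongr
                · exact hSle σ hσ'
                · exact hS'le σ hσ'
      _ = 2 * Θ * a * K := by
          rw [intervalIntegral.integral_const, smul_eq_mul]
          field_simp
          ring
  -- assemble
  have h2Θ : 0 ≤ 2 / Θ := by positivity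
  calc ∑ i ∈ T, w i * ‖weilMellin g (1 / 2 + β i + γ i * I)‖ ^ 2
      ≤ ∑ i ∈ T, w i * ((2 / Θ) * (∫ σ in (-(Θ / 2))..(Θ / 2), ‖F i σ‖ ^ 2) +
          ∫ σ in (-(Θ / 2))..(Θ / 2), 2 * (‖F i σ‖ * ‖F' i σ‖)) :=
        Finset.sum_le_sum fun i hi ↦ mul_le_mul_of_nonneg_left (hpt i hi) (hw i)
    _ = (2 / Θ) * ∑ i ∈ T, w i * (∫ σ in (-(Θ / 2))..(Θ / 2), ‖F i σ‖ ^ 2) +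
          ∑ i ∈ T, w i * ∫ σ in (-(Θ / 2))..(Θ / 2), 2 * (‖F i σ‖ * ‖F' i σ‖) := by
        rw [Finset.mul_sum, ← Finset.sum_add_distrib]
        refine Finset.sum_congr rfl fun i _ ↦ ?_
        ring
    _ ≤ (2 / Θ) * (Θ * K) + 2 * Θ * a * K := by gcongr
    _ = 2 * π * d * (1 + Θ * a) * (3 + a ^ 2) * Real.exp (Θ * a) * weilNorm2Sq g := by
        rw [hK]
        field_simp

/-! ### Sparse-exception exactness of the thermometer -/

/-- **Sparse-exception exactness of the thermometer.** Suppose every non-trivial zero has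
`|Re ρ − 1/2| ≤ Θ/2` and the OFF-LINE zeros have bounded local count: for every height `t` the
off-line zeros with `|Im ρ − t| ≤ 1/2`, counted with multiplicity, number at most `d`. Then the
ground energy of Weil's functional satisfies `ε(a) ≥ −C (1 + a)³ e^{Θa}` for all `a > 0`.
With `frequently_weilGroundEnergy_lt_of_offline_zero` (the `Ω`-form of the thermometer) this says:
the exponential rate of negativity of `ε` equals the width `Θ = sup |2 Re ρ − 1|` of the zero set
whenever off-line zeros do not cluster vertically without bound; a rate strictly above the width can
only come from unbounded vertical clustering of off-line zeros. The proof is real-variable: the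
on-line terms of `Re ∑ m(ρ) ĝ(ρ) conj ĝ(1 − ρ̄)` are `m |ĝ(ρ)|² ≥ 0`, the off-line ones are at least
`−(m/2)(|ĝ(ρ)|² + |ĝ(1 − ρ̄)|²)`, and both sampling sums are bounded on the `L²` sphere by a
one-sided Sobolev cell in `σ` inside the strip, the tilt `ĝ(1/2 + σ + it) = (g e^{σx})^(1/2 + it)` and
Gallagher's cell inequality with Plancherel on the critical line
(`sum_mul_norm_sq_weilMellin_strip_le`). [folklore] -/
theorem weilGroundEnergy_ge_of_sparse_offline {Θ d : ℝ}
    (hΘ : ∀ ρ ∈ ZetaZeros.riemannZetaNontrivialZeros, |ρ.re - 1 / 2| ≤ Θ / 2)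
    (hd : ∀ (t : ℝ) (T : Finset ZetaZeros.riemannZetaNontrivialZeros),
      (∀ ρ ∈ T, (ρ : ℂ).re ≠ 1 / 2 ∧ |(ρ : ℂ).im - t| ≤ 1 / 2) →
        ∑ ρ ∈ T, (riemannZetaZeroOrder (ρ : ℂ) : ℝ) ≤ d) :
    ∃ C : ℝ, 0 ≤ C ∧ ∀ a : ℝ, 0 < a →
      -(C * (1 + a) ^ 3 * Real.exp (Θ * a)) ≤ weilGroundEnergy a := by
  classical
  by_cases hoff : ∃ ρ ∈ ZetaZeros.riemannZetaNontrivialZeros, ρ.re ≠ 1 / 2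
  swap
  · push Not at hoff
    refine ⟨0, le_rfl, fun a ha ↦ ?_⟩
    simp only [zero_mul, neg_zero]
    refine le_weilGroundEnergy_of_forall ha fun g hg hsupp hn ↦ ?_
    rw [← combShapeDetection_zeroForm_eq_weilQuadratic hg, zeroForm, Complex.re_tsum (summable_pairCoeff hg)]
    exact tsum_nonneg fun ρ ↦ re_order_mul_pairCoeff_nonneg_of_re_eq_half g (hoff ρ ρ.2)
  obtain ⟨ρ₀, hρ₀, hρ₀off⟩ := hoff
  have hΘpos : 0 < Θ := by
    have h1 := hΘ ρ₀ hρ₀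
    have h2 : 0 < |ρ₀.re - 1 / 2| := abs_pos.2 (sub_ne_zero.2 hρ₀off)
    linarith
  have hd0 : 0 ≤ d := by simpa using hd 0 ∅ (by simp)
  set C : ℝ := 6 * π * d * (1 + Θ) with hC
  refine ⟨C, by positivity, fun a ha ↦ ?_⟩
  refine le_weilGroundEnergy_of_forall ha fun g hg hsupp hn ↦ ?_
  have hn' : weilNorm2Sq g = 1 := hn
  rw [← combShapeDetection_zeroForm_eq_weilQuadratic hg, zeroForm, Complex.re_tsum (summable_pairCoeff hg)]
  set m : ZetaZeros.riemannZetaNontrivialZeros → ℝ := fun ρ ↦ (riemannZetaZeroOrder (ρ : ℂ) : ℝ)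
    with hm
  have hm0 : ∀ ρ, 0 ≤ m ρ := fun ρ ↦ Int.cast_nonneg (by
    have := ZetaZeros.riemannZetaNontrivialZeros.one_le_order ρ.2
    omega)
  set E : ZetaZeros.riemannZetaNontrivialZeros → ℝ := fun ρ ↦
    if (ρ : ℂ).re = 1 / 2 then 0 else
      m ρ / 2 * (‖weilMellin g ρ‖ ^ 2 + ‖weilMellin g (1 - conj (ρ : ℂ))‖ ^ 2) with hE
  have hE0 : ∀ ρ, 0 ≤ E ρ := by
    intro ρ
    by_cases h : (ρ : ℂ).re = 1 / 2
    · simp [hE, h]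
    · simp only [hE, h, if_false]
      exact mul_nonneg (div_nonneg (hm0 ρ) zero_le_two) (by positivity)
  -- pointwise lower bound of the zero-side terms
  have hptE : ∀ ρ, -E ρ ≤ ((riemannZetaZeroOrder (ρ : ℂ) : ℂ) * pairCoeff g ρ).re := by
    intro ρ
    by_cases hρ : (ρ : ℂ).re = 1 / 2
    · simp only [hE, hρ, if_true, neg_zero]
      exact re_order_mul_pairCoeff_nonneg_of_re_eq_half g hρ
    · simp only [hE, hρ, if_false]
      have h1 : -‖(riemannZetaZeroOrder (ρ : ℂ) : ℂ) * pairCoeff g ρ‖ ≤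
          ((riemannZetaZeroOrder (ρ : ℂ) : ℂ) * pairCoeff g ρ).re :=
        (abs_le.1 (Complex.abs_re_le_norm _)).1
      refine le_trans ?_ h1
      rw [neg_le_neg_iff, norm_mul, Complex.norm_intCast, abs_of_nonneg (hm0 ρ), pairCoeff,
        norm_mul, Complex.norm_conj]
      have hu := norm_nonneg (weilMellin g ρ)
      have hv := norm_nonneg (weilMellin g (1 - conj (ρ : ℂ)))
      have h2 : ‖weilMellin g ρ‖ * ‖weilMellin g (1 - conj (ρ : ℂ))‖ ≤
          (‖weilMellin g ρ‖ ^ 2 + ‖weilMellin g (1 - conj (ρ : ℂ))‖ ^ 2) / 2 := by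
        nlinarith [sq_nonneg (‖weilMellin g ρ‖ - ‖weilMellin g (1 - conj (ρ : ℂ))‖)]
      calc (riemannZetaZeroOrder (ρ : ℂ) : ℝ) * (‖weilMellin g ρ‖ * ‖weilMellin g (1 - conj (ρ : ℂ))‖)
          ≤ (riemannZetaZeroOrder (ρ : ℂ) : ℝ) *
              ((‖weilMellin g ρ‖ ^ 2 + ‖weilMellin g (1 - conj (ρ : ℂ))‖ ^ 2) / 2) :=
            mul_le_mul_of_nonneg_left h2 (hm0 ρ)
        _ = m ρ / 2 * (‖weilMellin g ρ‖ ^ 2 + ‖weilMellin g (1 - conj (ρ : ℂ))‖ ^ 2) := by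
            rw [hm]; ring
  -- partial sums of `E` are bounded by the strip sampling bound
  set B : ℝ := 2 * π * d * (1 + Θ * a) * (3 + a ^ 2) * Real.exp (Θ * a) with hB
  have e1 : ∀ ρ : ZetaZeros.riemannZetaNontrivialZeros,
      (1 / 2 : ℂ) + (((ρ : ℂ).re - 1 / 2 : ℝ) : ℂ) + ((ρ : ℂ).im : ℂ) * I = (ρ : ℂ) := by
    intro ρ
    apply Complex.ext
    · simp
    · simp
  have e2 : ∀ ρ : ZetaZeros.riemannZetaNontrivialZeros,
      (1 / 2 : ℂ) + ((-((ρ : ℂ).re - 1 / 2) : ℝ) : ℂ) + ((ρ : ℂ).im : ℂ) * I = 1 - conj (ρ : ℂ) := by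
    intro ρ
    apply Complex.ext
    · simp; ring
    · simp
  have hpartial : ∀ T : Finset ZetaZeros.riemannZetaNontrivialZeros, ∑ ρ ∈ T, E ρ ≤ B := by
    intro T
    set T' := T.filter (fun ρ : ZetaZeros.riemannZetaNontrivialZeros ↦ (ρ : ℂ).re ≠ 1 / 2) with hT'
    have hsumE : ∑ ρ ∈ T, E ρ =
        ∑ ρ ∈ T', m ρ / 2 * (‖weilMellin g ρ‖ ^ 2 + ‖weilMellin g (1 - conj (ρ : ℂ))‖ ^ 2) := by
      rw [hT', Finset.sum_filter]
      refine Finset.sum_congr rfl fun ρ _ ↦ ?_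
      by_cases h : (ρ : ℂ).re = 1 / 2 <;> simp [hE, h]
    have hβ : ∀ ρ ∈ T', |(ρ : ℂ).re - 1 / 2| ≤ Θ / 2 := fun ρ _ ↦ hΘ ρ ρ.2
    have hβ' : ∀ ρ ∈ T', |(-((ρ : ℂ).re - 1 / 2))| ≤ Θ / 2 := fun ρ h ↦ by
      rw [abs_neg]; exact hβ ρ h
    have hloc : ∀ t : ℝ,
        ∑ ρ ∈ T'.filter (fun ρ : ZetaZeros.riemannZetaNontrivialZeros ↦ |(ρ : ℂ).im - t| ≤ 1 / 2), m ρ ≤ d := by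
      intro t
      refine hd t _ fun ρ hρ ↦ ?_
      simp only [hT', Finset.mem_filter] at hρ
      exact ⟨hρ.1.2, hρ.2⟩
    have hA := sum_mul_norm_sq_weilMellin_strip_le T'
      (fun ρ : ZetaZeros.riemannZetaNontrivialZeros ↦ (ρ : ℂ).re - 1 / 2)
      (fun ρ : ZetaZeros.riemannZetaNontrivialZeros ↦ (ρ : ℂ).im) m hm0 hΘpos hβ hloc hg ha hsupp
    have hA' := sum_mul_norm_sq_weilMellin_strip_le T'
      (fun ρ : ZetaZeros.riemannZetaNontrivialZeros ↦ -((ρ : ℂ).re - 1 / 2))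
      (fun ρ : ZetaZeros.riemannZetaNontrivialZeros ↦ (ρ : ℂ).im) m hm0 hΘpos hβ' hloc hg ha hsupp
    rw [hn', mul_one] at hA hA'
    have hA1 : ∑ ρ ∈ T', m ρ * ‖weilMellin g ρ‖ ^ 2 ≤ B := by
      refine le_trans (le_of_eq ?_) hA
      refine Finset.sum_congr rfl fun ρ _ ↦ ?_
      rw [e1 ρ]
    have hA2 : ∑ ρ ∈ T', m ρ * ‖weilMellin g (1 - conj (ρ : ℂ))‖ ^ 2 ≤ B := by
      refine le_trans (le_of_eq ?_) hA'
      refine Finset.sum_congr rfl fun ρ _ ↦ ?_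
      rw [e2 ρ]
    calc ∑ ρ ∈ T, E ρ
        = ∑ ρ ∈ T', m ρ / 2 * (‖weilMellin g ρ‖ ^ 2 + ‖weilMellin g (1 - conj (ρ : ℂ))‖ ^ 2) := hsumE
      _ = (1 / 2) * (∑ ρ ∈ T', m ρ * ‖weilMellin g ρ‖ ^ 2 +
            ∑ ρ ∈ T', m ρ * ‖weilMellin g (1 - conj (ρ : ℂ))‖ ^ 2) := by
          rw [← Finset.sum_add_distrib, Finset.mul_sum]
          refine Finset.sum_congr rfl fun ρ _ ↦ ?_
          ring
      _ ≤ (1 / 2) * (B + B) := by gcongr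
      _ = B := by ring
  have hEs : Summable E := summable_of_sum_le hE0 hpartial
  have hEt : ∑' ρ, E ρ ≤ B := hEs.tsum_le_of_sum_le hpartial
  have hsum : Summable fun ρ : ZetaZeros.riemannZetaNontrivialZeros ↦
      ((riemannZetaZeroOrder (ρ : ℂ) : ℂ) * pairCoeff g ρ).re :=
    (Complex.hasSum_re (summable_pairCoeff hg).hasSum).summable
  have hge : -B ≤ ∑' ρ : ZetaZeros.riemannZetaNontrivialZeros,
      ((riemannZetaZeroOrder (ρ : ℂ) : ℂ) * pairCoeff g ρ).re := by
    calc -B ≤ -∑' ρ, E ρ := neg_le_neg hEt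
      _ = ∑' ρ, -E ρ := tsum_neg.symm
      _ ≤ _ := hEs.neg.tsum_le_tsum hptE hsum
  refine le_trans ?_ hge
  apply neg_le_neg
  have h1 : 1 + Θ * a ≤ (1 + Θ) * (1 + a) := by nlinarith
  have h2 : 3 + a ^ 2 ≤ 3 * (1 + a) ^ 2 := by nlinarith
  calc B = 2 * π * d * ((1 + Θ * a) * (3 + a ^ 2)) * Real.exp (Θ * a) := by rw [hB]; ring
    _ ≤ 2 * π * d * ((1 + Θ) * (1 + a) * (3 * (1 + a) ^ 2)) * Real.exp (Θ * a) := by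
        gcongr
    _ = C * (1 + a) ^ 3 * Real.exp (Θ * a) := by rw [hC]; ring

end Summit.RiemannHypothesis.RiemannHypothesis.Theorems
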